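import Summits.NavierStokesRegularity.NavierStokesRegularity.Theorems.EulerZoomLiouvillePowerGaugeEulerLiouvilleWeakBernoulliTransportTools

/-!
# The similarity-Bernoulli transport law IN THE WEAK CLASS, II: the distributional identity (CIV (3.31) in `𝒟′(ℝ³)`)
# (crux `EulerZoomLiouville.PowerGaugeEulerLiouville` = stmt-NavierStokesRegularity-19832, line `birth`)

Width seat `ns-ezl-w1` (g6) under the crux LEAD, cell ns-regularity-ideate.  TOOL for the genuinely weak
exactly-self-similar stratum (open stub `stub_selfSimilarWeakRest`).

For a `C²` self-similar Euler profile `(V, P)` with exponent `γ` (Constantin–Ignatova–Vicol (3.3)), the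
similarity field `W = γy + V` (`selfSimilarTransport γ 0 V`) and the self-similar Bernoulli function
`ℋ = ½|W|² + P + ½γ(γ−1)|y|²` (`selfSimilarBernoulli γ 0 V P`) satisfy the transport identity (3.31)
`W·∇ℋ = (2γ−1)|W|²`, equivalently — with `div W = 3γ` — `div(ℋW) = 3γℋ − (1−2γ)|W|²`.  Every
Bernoulli-high-set argument of the lineage (piercing, channels, squeeze, «jets must turn») starts here, and
so far it was available only for classical profiles (Lagrangian `…SimilarityBernoulli`, pointwise
`IsSelfSimilarEulerProfile.fderiv_selfSimilarBernoulli_transport`).  This chain of three files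
(`…WeakBernoulliTransportTools` / `…WeakBernoulliTransport` / `…WeakBernoulliTransportMember`) proves it in
the sense of distributions for profiles WITHOUT ANY REGULARITY, from exactly the three weak identities the
lineage has transferred to the profile of a weak class member (`Past.profileData_of_past`): for every test
function `θ`,

  `∫ ℋ ⟪W, ∇θ⟫ = −3γ ∫ θ ℋ + (1 − 2γ) ∫ θ |W|²`,

given (E) the profile local energy EQUALITY, (M) the weak profile equation tested with the vector field
`ψ = θ·y`, and (W) weak incompressibility in the form `∫⟪W, ∇φ⟫ = −3γ∫φ` tested with `φ = θ|y|²`, for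
`V ∈ L⁶_loc`, `P ∈ L^{3/2}_loc` (the class data); pointwise the target integrand is
`−½·(E) + γ·(M) + ½γ(2γ−1)·(W)`.

THIS FILE: **`WeakBernoulli.weak_transport_law`** — the profile-level theorem (any `γ`): twelve integrable
atoms from the `L⁶ / L^{3/2}` data on the support of `θ`, the three packaged identities, the pointwise
bookkeeping, `linarith`.  The member level and the one-sided form are in `…WeakBernoulliTransportMember`.

WHAT THIS IS NOT: not NS, not E, not the stub — a weak-class TOOL (`--supports` stmt-19832): the Eulerian
transport structure of `ℋ` for the genuinely weak self-similar members, where no flow / ODE is available.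
[folklore; cf. ConstantinIgnatovaVicol2026Putative §3.4.3 (3.31)]
-/

noncomputable section

set_option linter.dupNamespace false

open MeasureTheory Set Filter Topology Metric Function TopologicalSpace
open scoped ENNReal NNReal RealInnerProductSpace ContDiff

namespace Summit.NavierStokesRegularity.NavierStokesRegularity.Theorems.PowerGaugeEulerLiouville

open Literature.Analysis Literature.Analysis.FunctionSpaces Literature.Analysis.FluidPDE

namespace WeakBernoulli

/-! ## The weak transport law (profile level) -/

section Law

variable {V : EuclideanSpace ℝ (Fin 3) → EuclideanSpace ℝ (Fin 3)} {P : EuclideanSpace ℝ (Fin 3) → ℝ}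

/-- **THE SIMILARITY-BERNOULLI TRANSPORT LAW IN THE WEAK CLASS (CIV (3.31) in `𝒟′(ℝ³)`).**  Let
`V ∈ L⁶_loc(ℝ³; ℝ³)` (`L⁶` on every ball), `P ∈ L^{3/2}_loc`, `V` weakly divergence free, and let `(V, P)`
satisfy, with exponent `γ`, the weak self-similar Euler profile equation
`∫ ⟪V,(V·∇)ψ⟫ + P div ψ + γ⟪V,(y·∇)ψ⟫ + (4γ−1)⟪V,ψ⟫ = 0` (every test field `ψ`) and the profile local
energy equality `(2−5γ)∫σ|V|² = ∫(|V|²+2P)⟪V,∇σ⟫ + γ∫|V|²⟪y,∇σ⟫` (every test function `σ`).  Then for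
`W = γy + V` (`selfSimilarTransport γ 0 V`) and `ℋ = ½|W|² + P + ½γ(γ−1)|y|²` (`selfSimilarBernoulli γ 0 V P`)
and every test function `θ`:
`∫ ℋ ⟪W, ∇θ⟫ = −3γ ∫ θ ℋ + (1 − 2γ) ∫ θ |W|²`,
i.e. `div(ℋ W) = 3γ ℋ − (1−2γ)|W|²` in the sense of distributions — the transport identity
`W·∇ℋ = (2γ−1)|W|²` of Constantin–Ignatova–Vicol (3.31) together with `div W = 3γ`, with NO regularity
assumed on the profile.  (Pointwise bookkeeping: the integrand `ℋ⟪W,∇θ⟫ + 3γθℋ − (1−2γ)θ|W|²` is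
`−½ ×` the energy integrand `+ γ ×` the momentum integrand tested with `ψ = θ·y` `+ ½γ(2γ−1) ×` the weak
divergence integrand tested with `θ|y|²`.) [folklore; cf. ConstantinIgnatovaVicol2026Putative §3.4.3 (3.31)] -/
theorem weak_transport_law {γ : ℝ} (hVm : AEStronglyMeasurable V volume) (hPm : AEStronglyMeasurable P volume)
    (hV6 : ∀ r : ℝ, MemLp V 6 (volume.restrict (ball (0 : EuclideanSpace ℝ (Fin 3)) r)))
    (hP : ∀ r : ℝ, MemLp P (3 / 2 : ℝ≥0∞) (volume.restrict (ball (0 : EuclideanSpace ℝ (Fin 3)) r)))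
    (hdiv : IsWeaklyDivFree V)
    (heq : ∀ ψ : EuclideanSpace ℝ (Fin 3) → EuclideanSpace ℝ (Fin 3),
      IsTestFunctionOn (⊤ : Opens (EuclideanSpace ℝ (Fin 3))) ψ →
        ∫ x, (⟪V x, fderiv ℝ ψ x (V x)⟫ + P x * VectorCalculus.divergence ψ x +
          γ * ⟪V x, fderiv ℝ ψ x x⟫ + (4 * γ - 1) * ⟪V x, ψ x⟫) = 0)
    (hen : ∀ σ : EuclideanSpace ℝ (Fin 3) → ℝ, IsTestFunctionOn (⊤ : Opens (EuclideanSpace ℝ (Fin 3))) σ →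
      (2 - 5 * γ) * ∫ x, σ x * ‖V x‖ ^ 2 =
        (∫ x, (‖V x‖ ^ 2 + 2 * P x) * ⟪V x, gradient σ x⟫) + γ * ∫ x, ‖V x‖ ^ 2 * ⟪x, gradient σ x⟫)
    {θ : EuclideanSpace ℝ (Fin 3) → ℝ} (hθ : IsTestFunctionOn (⊤ : Opens (EuclideanSpace ℝ (Fin 3))) θ) :
    ∫ y, selfSimilarBernoulli γ 0 V P y * ⟪selfSimilarTransport γ 0 V y, gradient θ y⟫ =
      -(3 * γ) * (∫ y, θ y * selfSimilarBernoulli γ 0 V P y) +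
        (1 - 2 * γ) * ∫ y, θ y * ‖selfSimilarTransport γ 0 V y‖ ^ 2 := by
  /- ### Step 0. Supports, constants, pointwise bounds -/
  obtain ⟨R₀, hR₀⟩ := hθ.hasCompactSupport.isCompact.isBounded.subset_ball (0 : EuclideanSpace ℝ (Fin 3))
  set R : ℝ := max R₀ 1 with hRdef
  have hR1 : 1 ≤ R := le_max_right _ _
  have hR0 : 0 ≤ R := zero_le_one.trans hR1
  set K : Set (EuclideanSpace ℝ (Fin 3)) := tsupport θ with hKdef
  have hKc : IsCompact K := hθ.hasCompactSupport
  have hKm : MeasurableSet K := (isClosed_tsupport θ).measurableSet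
  set B : Set (EuclideanSpace ℝ (Fin 3)) := ball (0 : EuclideanSpace ℝ (Fin 3)) R with hBdef
  have hKB : K ⊆ B := hR₀.trans (ball_subset_ball (le_max_left _ _))
  have hxK : ∀ x ∈ K, ‖x‖ ≤ R := fun x hx => by
    have := hKB hx; rw [mem_ball, dist_zero_right] at this; exact this.le
  have hθK : ∀ x, x ∉ K → θ x = 0 := fun x hx => image_eq_zero_of_notMem_tsupport hx
  have hθ1 : ContDiff ℝ 1 θ := hθ.contDiff.of_le (by exact_mod_cast le_top)
  have hθd : Differentiable ℝ θ := hθ1.differentiable one_ne_zero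
  have hθc : Continuous θ := hθ.contDiff.continuous
  have hgc : Continuous (gradient θ) := continuous_gradient_of_contDiff hθ1
  have hgK : ∀ x, x ∉ K → gradient θ x = 0 := fun x hx => gradient_eq_zero_of_notMem_tsupport hx
  obtain ⟨Cθ, hCθ⟩ := hθc.bounded_above_of_compact_support hθ.hasCompactSupport
  obtain ⟨Cg, hCg⟩ := hgc.bounded_above_of_compact_support
    (HasCompactSupport.intro hKc fun x hx => hgK x hx)
  have hCθ0 : 0 ≤ Cθ := (norm_nonneg _).trans (hCθ 0)
  have hCg0 : 0 ≤ Cg := (norm_nonneg _).trans (hCg 0)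
  have hsθ : ∀ x, |θ x| ≤ Cθ := fun x => (Real.norm_eq_abs _).symm.le.trans (hCθ x)
  have ha : ∀ x, |⟪V x, gradient θ x⟫| ≤ Cg * ‖V x‖ := fun x =>
    (abs_real_inner_le_norm _ _).trans
      (by rw [mul_comm]; exact mul_le_mul_of_nonneg_right (hCg x) (norm_nonneg _))
  have hb : ∀ x ∈ K, |⟪x, gradient θ x⟫| ≤ R * Cg := fun x hx =>
    (abs_real_inner_le_norm _ _).trans (mul_le_mul (hxK x hx) (hCg x) (norm_nonneg _) hR0)
  have hs : ∀ x ∈ K, |⟪V x, x⟫| ≤ R * ‖V x‖ := fun x hx =>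
    (abs_real_inner_le_norm _ _).trans
      (by rw [mul_comm]; exact mul_le_mul_of_nonneg_right (hxK x hx) (norm_nonneg _))
  have hm : ∀ x ∈ K, ‖x‖ ^ 2 ≤ R ^ 2 := fun x hx => pow_le_pow_left₀ (norm_nonneg _) (hxK x hx) 2
  have haK : ∀ x, x ∉ K → ⟪V x, gradient θ x⟫ = 0 := fun x hx => by rw [hgK x hx, inner_zero_right]
  have hbK : ∀ x, x ∉ K → ⟪x, gradient θ x⟫ = 0 := fun x hx => by rw [hgK x hx, inner_zero_right]
  /- ### Step 1. Local integrability on `K` from the `L⁶ / L^{3/2}` data -/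
  haveI hBfin : IsFiniteMeasure ((volume : Measure (EuclideanSpace ℝ (Fin 3))).restrict B) :=
    isFiniteMeasure_restrict.2 measure_ball_lt_top.ne
  have hV6B : MemLp V 6 (volume.restrict B) := hV6 R
  have hV3B : MemLp V 3 (volume.restrict B) := hV6B.mono_exponent (by norm_num)
  have hV2B : MemLp V 2 (volume.restrict B) := hV6B.mono_exponent (by norm_num)
  have hV1B : MemLp V 1 (volume.restrict B) := hV6B.mono_exponent (by norm_num)
  have hP32B : MemLp P (3 / 2 : ℝ≥0∞) (volume.restrict B) := hP R
  have hV3K : IntegrableOn (fun x => ‖V x‖ ^ 3) K volume :=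
    IntegrableOn.mono_set (show IntegrableOn (fun x => ‖V x‖ ^ 3) B volume from
      hV3B.integrable_norm_pow (by norm_num)) hKB
  have hV2K : IntegrableOn (fun x => ‖V x‖ ^ 2) K volume :=
    IntegrableOn.mono_set (show IntegrableOn (fun x => ‖V x‖ ^ 2) B volume from
      hV2B.integrable_norm_pow (by norm_num)) hKB
  have hV1K : IntegrableOn (fun x => ‖V x‖) K volume :=
    IntegrableOn.mono_set (show IntegrableOn (fun x => ‖V x‖) B volume from
      (memLp_one_iff_integrable.1 hV1B).norm) hKB
  have hP1K : IntegrableOn (fun x => |P x|) K volume := by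
    have h : IntegrableOn P B volume := memLp_one_iff_integrable.1 (hP32B.mono_exponent
      (by rw [ENNReal.le_div_iff_mul_le (Or.inl (by norm_num)) (Or.inl (by norm_num))]; norm_num))
    exact (h.mono_set hKB).abs
  have hPVK : IntegrableOn (fun x => |P x| * ‖V x‖) K volume := by
    haveI : ENNReal.HolderTriple (3 / 2 : ℝ≥0∞) 3 1 := by
      refine ⟨?_⟩
      rw [ENNReal.inv_div (Or.inr (by norm_num)) (Or.inr (by norm_num)), inv_one]
      have e3 : (3 : ℝ≥0∞)⁻¹ = ((3⁻¹ : ℝ≥0) : ℝ≥0∞) := by rw [ENNReal.coe_inv (by norm_num)]; norm_num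
      have e23 : (2 / 3 : ℝ≥0∞) = ((2 / 3 : ℝ≥0) : ℝ≥0∞) := by rw [ENNReal.coe_div (by norm_num)]; norm_num
      rw [e3, e23, ← ENNReal.coe_add, ← ENNReal.coe_one, ENNReal.coe_inj]
      norm_num
    have h1 : MemLp (fun x => |P x|) (3 / 2 : ℝ≥0∞) (volume.restrict B) := hP32B.abs
    have h2 : MemLp (fun x => ‖V x‖) 3 (volume.restrict B) := hV3B.norm
    have h3 : MemLp (fun x => |P x| * ‖V x‖) 1 (volume.restrict B) := by
      have := MemLp.mul (p := (3 / 2 : ℝ≥0∞)) (q := 3) (r := 1) h2 h1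
      simpa [Pi.mul_def, mul_comm] using this
    exact IntegrableOn.mono_set (memLp_one_iff_integrable.1 h3) hKB
  have h1K : IntegrableOn (fun _ : EuclideanSpace ℝ (Fin 3) => (1 : ℝ)) K volume :=
    integrableOn_const hKc.measure_lt_top.ne
  /- ### Step 2. The twelve integrable atoms -/
  have hma : AEStronglyMeasurable (fun x => ⟪V x, gradient θ x⟫) volume := hVm.inner hgc.aestronglyMeasurable
  have hmb : AEStronglyMeasurable (fun x : EuclideanSpace ℝ (Fin 3) => ⟪x, gradient θ x⟫) volume :=
    (continuous_id.inner hgc).aestronglyMeasurable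
  have hms : AEStronglyMeasurable (fun x => ⟪V x, x⟫) volume := hVm.inner continuous_id.aestronglyMeasurable
  have hmn : AEStronglyMeasurable (fun x => ‖V x‖ ^ 2) volume := hVm.norm.pow 2
  have hmm : AEStronglyMeasurable (fun x : EuclideanSpace ℝ (Fin 3) => ‖x‖ ^ 2) volume :=
    (continuous_norm.pow 2).aestronglyMeasurable
  have hmθ : AEStronglyMeasurable θ volume := hθc.aestronglyMeasurable
  have I_na : Integrable (fun x => ‖V x‖ ^ 2 * ⟪V x, gradient θ x⟫) volume := by
    refine ProfileEnergy.integrable_of_abs_le_on hKm (hmn.mul hma) hV3K (C := Cg) (fun x _ => ?_)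
      (fun x hx => by simp [haK x hx])
    rw [abs_mul, abs_of_nonneg (by positivity : (0 : ℝ) ≤ ‖V x‖ ^ 2),
      abs_of_nonneg (by positivity : (0 : ℝ) ≤ ‖V x‖ ^ 3)]
    calc ‖V x‖ ^ 2 * |⟪V x, gradient θ x⟫| ≤ ‖V x‖ ^ 2 * (Cg * ‖V x‖) :=
          mul_le_mul_of_nonneg_left (ha x) (by positivity)
      _ = Cg * ‖V x‖ ^ 3 := by ring
  have I_qa : Integrable (fun x => P x * ⟪V x, gradient θ x⟫) volume := by
    refine ProfileEnergy.integrable_of_abs_le_on hKm (hPm.mul hma) hPVK (C := Cg) (fun x _ => ?_)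
      (fun x hx => by simp [haK x hx])
    rw [abs_mul, abs_of_nonneg (by positivity : 0 ≤ |P x| * ‖V x‖)]
    calc |P x| * |⟪V x, gradient θ x⟫| ≤ |P x| * (Cg * ‖V x‖) :=
          mul_le_mul_of_nonneg_left (ha x) (abs_nonneg _)
      _ = Cg * (|P x| * ‖V x‖) := by ring
  have I_nb : Integrable (fun x => ‖V x‖ ^ 2 * ⟪x, gradient θ x⟫) volume := by
    refine ProfileEnergy.integrable_of_abs_le_on hKm (hmn.mul hmb) hV2K (C := R * Cg) (fun x hx => ?_)
      (fun x hx => by simp [hbK x hx])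
    rw [abs_mul, abs_of_nonneg (by positivity : (0 : ℝ) ≤ ‖V x‖ ^ 2)]
    calc ‖V x‖ ^ 2 * |⟪x, gradient θ x⟫| ≤ ‖V x‖ ^ 2 * (R * Cg) :=
          mul_le_mul_of_nonneg_left (hb x hx) (by positivity)
      _ = R * Cg * ‖V x‖ ^ 2 := by ring
  have I_sa : Integrable (fun x => ⟪V x, x⟫ * ⟪V x, gradient θ x⟫) volume := by
    refine ProfileEnergy.integrable_of_abs_le_on hKm (hms.mul hma) hV2K (C := R * Cg) (fun x hx => ?_)
      (fun x hx => by simp [haK x hx])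
    rw [abs_mul, abs_of_nonneg (by positivity : (0 : ℝ) ≤ ‖V x‖ ^ 2)]
    calc |⟪V x, x⟫| * |⟪V x, gradient θ x⟫| ≤ (R * ‖V x‖) * (Cg * ‖V x‖) :=
          mul_le_mul (hs x hx) (ha x) (abs_nonneg _) (by positivity)
      _ = R * Cg * ‖V x‖ ^ 2 := by ring
  have I_sb : Integrable (fun x => ⟪V x, x⟫ * ⟪x, gradient θ x⟫) volume := by
    refine ProfileEnergy.integrable_of_abs_le_on hKm (hms.mul hmb) hV1K (C := R * (R * Cg))
      (fun x hx => ?_) (fun x hx => by simp [hbK x hx])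
    rw [abs_mul, abs_norm]
    calc |⟪V x, x⟫| * |⟪x, gradient θ x⟫| ≤ (R * ‖V x‖) * (R * Cg) :=
          mul_le_mul (hs x hx) (hb x hx) (abs_nonneg _) (by positivity)
      _ = R * (R * Cg) * ‖V x‖ := by ring
  have I_qb : Integrable (fun x => P x * ⟪x, gradient θ x⟫) volume := by
    refine ProfileEnergy.integrable_of_abs_le_on hKm (hPm.mul hmb) hP1K (C := R * Cg) (fun x hx => ?_)
      (fun x hx => by simp [hbK x hx])
    rw [abs_mul, abs_abs]
    calc |P x| * |⟪x, gradient θ x⟫| ≤ |P x| * (R * Cg) := mul_le_mul_of_nonneg_left (hb x hx) (abs_nonneg _)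
      _ = R * Cg * |P x| := by ring
  have I_ma : Integrable (fun x => ‖x‖ ^ 2 * ⟪V x, gradient θ x⟫) volume := by
    refine ProfileEnergy.integrable_of_abs_le_on hKm (hmm.mul hma) hV1K (C := R ^ 2 * Cg) (fun x hx => ?_)
      (fun x hx => by simp [haK x hx])
    rw [abs_mul, abs_norm, abs_of_nonneg (by positivity : (0 : ℝ) ≤ ‖x‖ ^ 2)]
    calc ‖x‖ ^ 2 * |⟪V x, gradient θ x⟫| ≤ R ^ 2 * (Cg * ‖V x‖) :=
          mul_le_mul (hm x hx) (ha x) (abs_nonneg _) (by positivity)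
      _ = R ^ 2 * Cg * ‖V x‖ := by ring
  have I_mb : Integrable (fun x : EuclideanSpace ℝ (Fin 3) => ‖x‖ ^ 2 * ⟪x, gradient θ x⟫) volume := by
    refine ProfileEnergy.integrable_of_abs_le_on hKm (hmm.mul hmb) h1K (C := R ^ 2 * (R * Cg))
      (fun x hx => ?_) (fun x hx => by simp [hbK x hx])
    rw [abs_mul, abs_one, mul_one, abs_of_nonneg (by positivity : (0 : ℝ) ≤ ‖x‖ ^ 2)]
    exact mul_le_mul (hm x hx) (hb x hx) (abs_nonneg _) (by positivity)
  have I_nt : Integrable (fun x => θ x * ‖V x‖ ^ 2) volume := by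
    refine ProfileEnergy.integrable_of_abs_le_on hKm (hmθ.mul hmn) hV2K (C := Cθ) (fun x _ => ?_)
      (fun x hx => by simp [hθK x hx])
    rw [abs_mul]
    exact mul_le_mul_of_nonneg_right (hsθ x) (abs_nonneg _)
  have I_st : Integrable (fun x => θ x * ⟪V x, x⟫) volume := by
    refine ProfileEnergy.integrable_of_abs_le_on hKm (hmθ.mul hms) hV1K (C := Cθ * R) (fun x hx => ?_)
      (fun x hx => by simp [hθK x hx])
    rw [abs_mul, abs_norm]
    calc |θ x| * |⟪V x, x⟫| ≤ Cθ * (R * ‖V x‖) := mul_le_mul (hsθ x) (hs x hx) (abs_nonneg _) hCθ0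
      _ = Cθ * R * ‖V x‖ := by ring
  have I_qt : Integrable (fun x => θ x * P x) volume := by
    refine ProfileEnergy.integrable_of_abs_le_on hKm (hmθ.mul hPm) hP1K (C := Cθ) (fun x _ => ?_)
      (fun x hx => by simp [hθK x hx])
    rw [abs_mul, abs_abs]
    exact mul_le_mul_of_nonneg_right (hsθ x) (abs_nonneg _)
  have I_mt : Integrable (fun x : EuclideanSpace ℝ (Fin 3) => θ x * ‖x‖ ^ 2) volume := by
    refine ProfileEnergy.integrable_of_abs_le_on hKm (hmθ.mul hmm) h1K (C := Cθ * R ^ 2) (fun x hx => ?_)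
      (fun x hx => by simp [hθK x hx])
    rw [abs_mul, abs_one, mul_one, abs_of_nonneg (by positivity : (0 : ℝ) ≤ ‖x‖ ^ 2)]
    exact mul_le_mul (hsθ x) (hm x hx) (by positivity) hCθ0
  /- ### Step 3. The three packaged weak identities: energy (E), momentum tested with `θ·y` (M),
  weak divergence tested with `θ|y|²` (W) -/
  -- (E)
  obtain ⟨fE, hfE⟩ : ∃ f : EuclideanSpace ℝ (Fin 3) → ℝ, f = fun x =>
      (2 - 5 * γ) * (θ x * ‖V x‖ ^ 2) - (‖V x‖ ^ 2 + 2 * P x) * ⟪V x, gradient θ x⟫ -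
        γ * (‖V x‖ ^ 2 * ⟪x, gradient θ x⟫) := ⟨_, rfl⟩
  have I_Ea : Integrable (fun x => (‖V x‖ ^ 2 + 2 * P x) * ⟪V x, gradient θ x⟫) volume := by
    refine (I_na.add (I_qa.const_mul 2)).congr (Eventually.of_forall fun x => ?_)
    simp only [Pi.add_apply]; ring
  have I_E1 : Integrable (fun x => (2 - 5 * γ) * (θ x * ‖V x‖ ^ 2)) volume := I_nt.const_mul _
  have I_E3 : Integrable (fun x => γ * (‖V x‖ ^ 2 * ⟪x, gradient θ x⟫)) volume := I_nb.const_mul _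
  have I_E : Integrable fE volume := by rw [hfE]; exact (I_E1.sub I_Ea).sub I_E3
  have hE0 : ∫ x, fE x = 0 := by
    have e1 : ∫ x, fE x = (∫ x, ((2 - 5 * γ) * (θ x * ‖V x‖ ^ 2) -
        (‖V x‖ ^ 2 + 2 * P x) * ⟪V x, gradient θ x⟫)) - ∫ x, γ * (‖V x‖ ^ 2 * ⟪x, gradient θ x⟫) := by
      rw [hfE]; exact integral_sub (I_E1.sub I_Ea) I_E3
    have e2 : ∫ x, ((2 - 5 * γ) * (θ x * ‖V x‖ ^ 2) - (‖V x‖ ^ 2 + 2 * P x) * ⟪V x, gradient θ x⟫) =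
        (∫ x, (2 - 5 * γ) * (θ x * ‖V x‖ ^ 2)) - ∫ x, (‖V x‖ ^ 2 + 2 * P x) * ⟪V x, gradient θ x⟫ :=
      integral_sub I_E1 I_Ea
    have e3 : ∫ x, (2 - 5 * γ) * (θ x * ‖V x‖ ^ 2) = (2 - 5 * γ) * ∫ x, θ x * ‖V x‖ ^ 2 :=
      integral_const_mul _ _
    have e4 : ∫ x, γ * (‖V x‖ ^ 2 * ⟪x, gradient θ x⟫) = γ * ∫ x, ‖V x‖ ^ 2 * ⟪x, gradient θ x⟫ :=
      integral_const_mul _ _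
    rw [e1, e2, e3, e4, hen θ hθ]
    ring
  -- (M): the test field `ψ = θ·y`
  have hψ : IsTestFunctionOn (⊤ : Opens (EuclideanSpace ℝ (Fin 3))) (fun y => θ y • y) :=
    ProfileEnergy.isTestFunctionOn_smul (W := fun y => y) hθ contDiff_id
  have hidD : Differentiable ℝ (fun y : EuclideanSpace ℝ (Fin 3) => y) := differentiable_id
  have hidDat : ∀ x : EuclideanSpace ℝ (Fin 3), DifferentiableAt ℝ (fun y : EuclideanSpace ℝ (Fin 3) => y) x :=
    fun x => differentiableAt_id
  obtain ⟨fM, hfM⟩ : ∃ f : EuclideanSpace ℝ (Fin 3) → ℝ, f = fun x =>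
      ⟪V x, fderiv ℝ (fun y => θ y • y) x (V x)⟫ + P x * VectorCalculus.divergence (fun y => θ y • y) x +
        γ * ⟪V x, fderiv ℝ (fun y => θ y • y) x x⟫ + (4 * γ - 1) * ⟪V x, θ x • x⟫ := ⟨_, rfl⟩
  have hM0 : ∫ x, fM x = 0 := by rw [hfM]; exact heq _ hψ
  have hfM' : ∀ x, fM x = ⟪V x, x⟫ * ⟪V x, gradient θ x⟫ + θ x * ‖V x‖ ^ 2 + 3 * (θ x * P x) +
      P x * ⟪x, gradient θ x⟫ + γ * (⟪V x, x⟫ * ⟪x, gradient θ x⟫) + (5 * γ - 1) * (θ x * ⟪V x, x⟫) := by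
    intro x
    rw [hfM]
    simp only []
    rw [ProfileEnergy.fderiv_smul_apply_of_differentiable (W := fun y => y) hθd hidD,
      ProfileEnergy.fderiv_smul_apply_of_differentiable (W := fun y => y) hθd hidD, fderiv_fun_id,
      divergence_smul_apply (hθd x) (hidDat x), Sverak2011.divergence_id_three,
      ← inner_gradient_eq_fderiv_apply, ← inner_gradient_eq_fderiv_apply]
    simp only [ContinuousLinearMap.coe_id', id_eq, inner_add_right, real_inner_smul_right,
      real_inner_self_eq_norm_sq]
    ring
  have I_M : Integrable fM volume := by
    refine ((((((I_sa.add I_nt).add (I_qt.const_mul 3)).add I_qb).add (I_sb.const_mul γ)).add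
      (I_st.const_mul (5 * γ - 1))).congr (Eventually.of_forall fun x => ?_))
    rw [hfM' x]; simp only [Pi.add_apply]
  -- (W): the test function `φ = θ|y|²`
  have hφ : IsTestFunctionOn (⊤ : Opens (EuclideanSpace ℝ (Fin 3))) (fun y => θ y * ‖y‖ ^ 2) :=
    ⟨hθ.contDiff.mul (contDiff_norm_sq ℝ), hθ.hasCompactSupport.mul_right, by simp⟩
  obtain ⟨fW, hfW⟩ : ∃ f : EuclideanSpace ℝ (Fin 3) → ℝ, f = fun x =>
      ⟪selfSimilarTransport γ 0 V x, gradient (fun y => θ y * ‖y‖ ^ 2) x⟫ + 3 * γ * (θ x * ‖x‖ ^ 2) :=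
    ⟨_, rfl⟩
  have hfW1 : ∀ x, ⟪selfSimilarTransport γ 0 V x, gradient (fun y => θ y * ‖y‖ ^ 2) x⟫ =
      γ * (‖x‖ ^ 2 * ⟪x, gradient θ x⟫) + ‖x‖ ^ 2 * ⟪V x, gradient θ x⟫ +
        2 * γ * (θ x * ‖x‖ ^ 2) + 2 * (θ x * ⟪V x, x⟫) := by
    intro x
    rw [inner_gradient_eq_fderiv_apply, fderiv_mul_normSq_apply hθd, ← inner_gradient_eq_fderiv_apply,
      Logistic.inner_selfSimilarTransport_left, inner_transport_zero_right, real_inner_self_eq_norm_sq, real_inner_comm (V x) x]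
    ring
  have hfW' : ∀ x, fW x = γ * (‖x‖ ^ 2 * ⟪x, gradient θ x⟫) + ‖x‖ ^ 2 * ⟪V x, gradient θ x⟫ +
      2 * γ * (θ x * ‖x‖ ^ 2) + 2 * (θ x * ⟪V x, x⟫) + 3 * γ * (θ x * ‖x‖ ^ 2) := by
    intro x; rw [hfW]; simp only []; rw [hfW1 x]
  have I_W1 : Integrable (fun x => ⟪selfSimilarTransport γ 0 V x, gradient (fun y => θ y * ‖y‖ ^ 2) x⟫)
      volume := by
    refine ((((I_mb.const_mul γ).add I_ma).add (I_mt.const_mul (2 * γ))).add (I_st.const_mul 2)).congr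
      (Eventually.of_forall fun x => ?_)
    simp only [Pi.add_apply]
    rw [hfW1 x]
  have I_W2 : Integrable (fun x : EuclideanSpace ℝ (Fin 3) => 3 * γ * (θ x * ‖x‖ ^ 2)) volume :=
    I_mt.const_mul _
  have hW0 : ∫ x, fW x = 0 := by
    have e1 : ∫ x, fW x = (∫ x, ⟪selfSimilarTransport γ 0 V x, gradient (fun y => θ y * ‖y‖ ^ 2) x⟫) +
        ∫ x, 3 * γ * (θ x * ‖x‖ ^ 2) := by
      rw [hfW]; exact integral_add I_W1 I_W2
    have e2 : ∫ x : EuclideanSpace ℝ (Fin 3), 3 * γ * (θ x * ‖x‖ ^ 2) =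
        3 * γ * ∫ x : EuclideanSpace ℝ (Fin 3), θ x * ‖x‖ ^ 2 := integral_const_mul _ _
    rw [e1, e2, integral_inner_transport_gradient (locallyIntegrable_of_memLp_six_ball hV6) hdiv hφ]
    ring
  have I_W : Integrable fW volume := by rw [hfW]; exact I_W1.add I_W2
  /- ### Step 4. The target integrand is `−½ fE + γ fM + ½γ(2γ−1) fW` pointwise -/
  have I_L : Integrable (fun y => selfSimilarBernoulli γ 0 V P y *
      ⟪selfSimilarTransport γ 0 V y, gradient θ y⟫) volume := by
    refine (((((((I_na.const_mul (1 / 2 : ℝ)).add I_qa).add (I_nb.const_mul (γ / 2))).add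
      (I_sa.const_mul γ)).add (I_sb.const_mul (γ ^ 2))).add (I_qb.const_mul γ)).add
      ((I_mb.const_mul (γ * (2 * γ - 1) / 2 * γ)).add (I_ma.const_mul (γ * (2 * γ - 1) / 2)))).congr
      (Eventually.of_forall fun y => ?_)
    simp only [Pi.add_apply]
    rw [bernoulli_zero_apply, Logistic.inner_selfSimilarTransport_left]
    ring
  have I_R1 : Integrable (fun y => θ y * selfSimilarBernoulli γ 0 V P y) volume := by
    refine ((((I_nt.const_mul (1 / 2 : ℝ)).add (I_st.const_mul γ)).add I_qt).add
      (I_mt.const_mul (γ * (2 * γ - 1) / 2))).congr (Eventually.of_forall fun y => ?_)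
    simp only [Pi.add_apply]
    rw [bernoulli_zero_apply]
    ring
  have I_R2 : Integrable (fun y => θ y * ‖selfSimilarTransport γ 0 V y‖ ^ 2) volume := by
    refine (((I_mt.const_mul (γ ^ 2)).add (I_st.const_mul (2 * γ))).add I_nt).congr
      (Eventually.of_forall fun y => ?_)
    simp only [Pi.add_apply]
    rw [norm_transport_zero_sq]
    ring
  -- the pointwise bookkeeping identity
  have hpt : ∀ y, selfSimilarBernoulli γ 0 V P y * ⟪selfSimilarTransport γ 0 V y, gradient θ y⟫ +
      3 * γ * (θ y * selfSimilarBernoulli γ 0 V P y) - (1 - 2 * γ) * (θ y * ‖selfSimilarTransport γ 0 V y‖ ^ 2) =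
      -(1 / 2 : ℝ) * fE y + γ * fM y + γ * (2 * γ - 1) / 2 * fW y := by
    intro y
    rw [hfM' y, hfW' y, hfE]
    simp only []
    rw [bernoulli_zero_apply, Logistic.inner_selfSimilarTransport_left, norm_transport_zero_sq]
    ring
  -- integrate the bookkeeping identity
  have hT1 : ∫ y, (selfSimilarBernoulli γ 0 V P y * ⟪selfSimilarTransport γ 0 V y, gradient θ y⟫ +
      3 * γ * (θ y * selfSimilarBernoulli γ 0 V P y) - (1 - 2 * γ) * (θ y * ‖selfSimilarTransport γ 0 V y‖ ^ 2)) =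
      (∫ y, (selfSimilarBernoulli γ 0 V P y * ⟪selfSimilarTransport γ 0 V y, gradient θ y⟫ +
        3 * γ * (θ y * selfSimilarBernoulli γ 0 V P y))) -
        ∫ y, (1 - 2 * γ) * (θ y * ‖selfSimilarTransport γ 0 V y‖ ^ 2) :=
    integral_sub (I_L.add (I_R1.const_mul (3 * γ))) (I_R2.const_mul (1 - 2 * γ))
  have hT1b : ∫ y, (selfSimilarBernoulli γ 0 V P y * ⟪selfSimilarTransport γ 0 V y, gradient θ y⟫ +
      3 * γ * (θ y * selfSimilarBernoulli γ 0 V P y)) =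
      (∫ y, selfSimilarBernoulli γ 0 V P y * ⟪selfSimilarTransport γ 0 V y, gradient θ y⟫) +
        ∫ y, 3 * γ * (θ y * selfSimilarBernoulli γ 0 V P y) :=
    integral_add I_L (I_R1.const_mul (3 * γ))
  have hT1c : ∫ y, 3 * γ * (θ y * selfSimilarBernoulli γ 0 V P y) =
      3 * γ * ∫ y, θ y * selfSimilarBernoulli γ 0 V P y := integral_const_mul _ _
  have hT1d : ∫ y, (1 - 2 * γ) * (θ y * ‖selfSimilarTransport γ 0 V y‖ ^ 2) =
      (1 - 2 * γ) * ∫ y, θ y * ‖selfSimilarTransport γ 0 V y‖ ^ 2 := integral_const_mul _ _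
  have hT2 : ∫ y, (selfSimilarBernoulli γ 0 V P y * ⟪selfSimilarTransport γ 0 V y, gradient θ y⟫ +
      3 * γ * (θ y * selfSimilarBernoulli γ 0 V P y) - (1 - 2 * γ) * (θ y * ‖selfSimilarTransport γ 0 V y‖ ^ 2)) =
      ∫ y, (-(1 / 2 : ℝ) * fE y + γ * fM y + γ * (2 * γ - 1) / 2 * fW y) :=
    integral_congr_ae (Eventually.of_forall hpt)
  have hT2b : ∫ y, (-(1 / 2 : ℝ) * fE y + γ * fM y + γ * (2 * γ - 1) / 2 * fW y) =
      (∫ y, (-(1 / 2 : ℝ) * fE y + γ * fM y)) + ∫ y, γ * (2 * γ - 1) / 2 * fW y :=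
    integral_add ((I_E.const_mul (-(1 / 2 : ℝ))).add (I_M.const_mul γ)) (I_W.const_mul (γ * (2 * γ - 1) / 2))
  have hT2c : ∫ y, (-(1 / 2 : ℝ) * fE y + γ * fM y) = (∫ y, -(1 / 2 : ℝ) * fE y) + ∫ y, γ * fM y :=
    integral_add (I_E.const_mul (-(1 / 2 : ℝ))) (I_M.const_mul γ)
  have hT2d : ∫ y, -(1 / 2 : ℝ) * fE y = -(1 / 2 : ℝ) * ∫ y, fE y := integral_const_mul _ _
  have hT2e : ∫ y, γ * fM y = γ * ∫ y, fM y := integral_const_mul _ _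
  have hT2f : ∫ y, γ * (2 * γ - 1) / 2 * fW y = γ * (2 * γ - 1) / 2 * ∫ y, fW y := integral_const_mul _ _
  /- ### Step 5. Conclusion -/
  rw [hE0] at hT2d
  rw [hM0] at hT2e
  rw [hW0] at hT2f
  linarith

end Law

end WeakBernoulli

end Summit.NavierStokesRegularity.NavierStokesRegularity.Theorems.PowerGaugeEulerLiouville
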